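import Summits.KontsevichZagierPeriods.KontsevichZagierPeriods.Theorems.RootDecompQuadraticDescentPair18HomotopyP05

/-! # `RootDecompQuadraticDescentPair18HomotopyP06` — part 6/31 of the mechanical ≤400-line split of `Pair18Homotopy_v14_noguard.lean` (sha256 72e9c8442b4af820…)
Source: decomp-kz lens-6 g9 `Pair18Homotopy.lean` v14 (HOME/decomp-kz-lens-6/g9/, sha256 3dda3232…; critic g4-48/g4-53/g4-56/g5 CLEARED; census pair #18 of crux stmt-KontsevichZagierPeriods-28994: homotopy cells, duplications, inversions, Euler–Landen, arc/angle regions; terminal `pair18_g8strips_of_grid : hEuler → hGrid → hAng4 → (g8 form of #18)`); `#guard_msgs … #print axioms` pins removed for landing.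
Split by census-1 g9 `gen/splitlean.py`: scopes re-opened with their `open`/`variable`/`set_option` context; mathematics and declaration order unchanged. -/

set_option linter.unusedSimpArgs false
noncomputable section
open _root_.Set MvPolynomial
namespace Summit.KontsevichZagierPeriods.RootDecompQuadraticDescent.Pair18Homotopy
open Literature.NumberTheory.Transcendental
open Literature.NumberTheory.Transcendental.KZ (RFun cube)
open Summit.KontsevichZagierPeriods.RootDecompQuadraticDescent.DarkPairs (rel_reflect_rep rel_double)
/-- Auxiliary step `vec2_1` (§2b): vec2 1. [bookkeeping] -/
private theorem vec2_1 (a b : ℝ) : (![a, b] : Fin 2 → ℝ) 1 = b := rfl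

/-- Auxiliary step `vec2_0` (§2b): vec2 0. [bookkeeping] -/
private theorem vec2_0 (a b : ℝ) : (![a, b] : Fin 2 → ℝ) 0 = a := rfl

/-- Dyadic subdivision of the square along the coordinate `i` (rules 1+2).
[cite: KontsevichZagier2001, §1.2 rules 1, 2] -/
private theorem rel_subdiv (i : Fin 2) (T T₁ T₂ : RFun 2)
    (h₁ : ∀ x ∈ cube 2, T₁.fn x = (1 / 2 : ℝ) * T.fn (Function.update x i (x i / 2)))
    (h₂ : ∀ x ∈ cube 2, T₂.fn x = (1 / 2 : ℝ) * T.fn (Function.update x i ((1 + x i) / 2))) :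
    KZ.of T.rep - KZ.of T₁.rep - KZ.of T₂.rep ∈ KZ.relations :=
  KZ.cubicalSubdivGens_subset_relations ⟨2, T.rep, T₁.rep, T₂.rep, i, rfl, T.analyticOnNhd_fn, rfl,
    T₁.analyticOnNhd_fn, rfl, T₂.analyticOnNhd_fn, h₁, h₂, rfl⟩

section Inv

/-- the Möbius coordinate `2x/(1+x)` as a regular rational function (for semialgebraicity) -/
def Mob : RFun 2 := ⟨C 2 * X 0, C 1 + X 0, fun x hx => by
  have h0 := (hx 0).1
  simp only [map_add, map_sub, map_mul, map_pow, map_neg, aeval_C, aeval_X, map_one, map_ofNat,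
      eq_ratCast, Rat.cast_one, Rat.cast_ofNat, Rat.cast_div, Rat.cast_neg, Rat.cast_zero]
  positivity⟩

/-- **The Möbius self-map `x ↦ 2x/(1+x)` of the square (rule 2, Jacobian `2/(1+x)²`).**
If `T(x,y) = S(2x/(1+x), y)·2/(1+x)²` on `[0,1]²` then `[T] − [S] ∈ KZ.relations`.
[cite: KontsevichZagier2001, §1.2 rule 2] -/
theorem rel_moeb (T S : RFun 2)
    (h : ∀ z ∈ cube 2, T.fn z = S.fn ![2 * z 0 / (1 + z 0), z 1] * (2 / (1 + z 0) ^ 2)) :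
    KZ.of T.rep - KZ.of S.rep ∈ KZ.relations := by
  let Φ : (Fin 2 → ℝ) → (Fin 2 → ℝ) := fun z => ![2 * z 0 / (1 + z 0), z 1]
  let Mz : (Fin 2 → ℝ) → Matrix (Fin 2) (Fin 2) ℝ := fun z => !![2 / (1 + z 0) ^ 2, 0; 0, 1]
  let Φ' : (Fin 2 → ℝ) → (Fin 2 → ℝ) →L[ℝ] (Fin 2 → ℝ) := fun z =>
    LinearMap.toContinuousLinearMap (Matrix.toLin' (Mz z))
  have hΦ'ap : ∀ z w, Φ' z w = ![2 / (1 + z 0) ^ 2 * w 0, w 1] := by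
    intro z w; funext i
    fin_cases i <;> simp [Φ', Mz, Matrix.toLin'_apply, Matrix.mulVec, dotProduct, Fin.sum_univ_two]
  have hdet : ∀ z, (Φ' z).det = 2 / (1 + z 0) ^ 2 := by
    intro z
    unfold ContinuousLinearMap.det
    simp [Φ', LinearMap.det_toLin', Mz, Matrix.det_fin_two]
  have hdom : S.rep.domain = Φ '' T.rep.domain := by
    rw [RFun.rep_domain, RFun.rep_domain]
    ext w
    constructor
    · intro hw
      have hw0 := (hw 0).1
      have hw1 := (hw 0).2
      have h2 : (0 : ℝ) < 2 - w 0 := by linarith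
      refine ⟨![w 0 / (2 - w 0), w 1], ?_, ?_⟩
      · intro i
        fin_cases i
        · exact ⟨by simpa using div_nonneg hw0 h2.le, by
            simpa using (div_le_one h2).mpr (by linarith)⟩
        · exact hw 1
      · funext i
        fin_cases i
        · have h3 : (2 : ℝ) - w 0 ≠ 0 := h2.ne'
          have key : 2 * (w 0 / (2 - w 0)) / (1 + w 0 / (2 - w 0)) = w 0 := by
            field_simp
            ring
          simpa [Φ] using key
        · simp [Φ]
    · rintro ⟨z, hz, rfl⟩
      have hz0 := (hz 0).1
      have hz1 := (hz 0).2
      intro i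
      fin_cases i
      · refine ⟨by simpa [Φ] using div_nonneg (by linarith) (by linarith), ?_⟩
        simpa [Φ] using (div_le_one (by linarith)).mpr (by linarith)
      · simpa [Φ] using hz 1
  refine KZ.changeOfVariablesRel_subset_relations ⟨2, T.rep, S.rep, Φ, Φ', ?_, ?_, ?_, hdom, ?_, rfl⟩
  · refine (isSemialgebraicMapOn_iff_forall_holds T.rep.isSemialgebraic_domain).mpr fun i => ?_
    fin_cases i
    · exact Mob.isSemialgebraicFunOn_fn.congr fun z _ => by
        simp [Φ, Mob, RFun.fn, map_add, map_sub, map_mul, map_pow, map_neg, aeval_C, aeval_X, map_one, map_ofNat,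
      eq_ratCast, Rat.cast_one, Rat.cast_ofNat, Rat.cast_div, Rat.cast_neg, Rat.cast_zero]
    · exact (isSemialgebraicFunOn_aeval T.rep.isSemialgebraic_domain (X 1)).congr fun z _ => by
        simp [Φ]
  · intro z hz
    have hz0 : (0 : ℝ) ≤ z 0 := (hz 0).1
    have hne : (1 : ℝ) + z 0 ≠ 0 := by positivity
    have hκ : HasDerivAt (fun t : ℝ => 2 * t / (1 + t)) (2 / (1 + z 0) ^ 2) (z 0) := by
      have := (((hasDerivAt_id' (z 0)).const_mul 2).div ((hasDerivAt_id' (z 0)).const_add 1) hne)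
      refine this.congr_deriv ?_
      field_simp
      ring
    have h0 : HasFDerivAt (fun w : Fin 2 → ℝ => 2 * w 0 / (1 + w 0))
        ((2 / (1 + z 0) ^ 2) • ContinuousLinearMap.proj (R := ℝ) (φ := fun _ : Fin 2 => ℝ) 0) z :=
      HasDerivAt.comp_hasFDerivAt (𝕜 := ℝ) (h₂ := fun t : ℝ => 2 * t / (1 + t))
        (f := fun w : Fin 2 → ℝ => w 0) z hκ (hasFDerivAt_apply (𝕜 := ℝ) 0 z)
    have h1 : HasFDerivAt (fun w : Fin 2 → ℝ => w 1)
        (ContinuousLinearMap.proj (R := ℝ) (φ := fun _ : Fin 2 => ℝ) 1) z := hasFDerivAt_apply 1 z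
    have hpi : HasFDerivAt Φ (Φ' z) z := by
      rw [hasFDerivAt_pi']
      intro i
      fin_cases i
      · have e : (ContinuousLinearMap.proj (R := ℝ) (φ := fun _ : Fin 2 => ℝ) 0).comp (Φ' z) =
            (2 / (1 + z 0) ^ 2) • ContinuousLinearMap.proj (R := ℝ) (φ := fun _ : Fin 2 => ℝ) 0 := by
          ext w; simp [hΦ'ap]
        simpa [e, Φ, Function.comp_def] using h0
      · have e : (ContinuousLinearMap.proj (R := ℝ) (φ := fun _ : Fin 2 => ℝ) 1).comp (Φ' z) =
            ContinuousLinearMap.proj (R := ℝ) (φ := fun _ : Fin 2 => ℝ) 1 := by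
          ext w; simp [hΦ'ap]
        simpa [e, Φ] using h1
    exact hpi.hasFDerivWithinAt
  · intro z₁ hz₁ z₂ hz₂ heq
    have ha := (hz₁ 0).1
    have hb := (hz₂ 0).1
    have e0 : 2 * z₁ 0 / (1 + z₁ 0) = 2 * z₂ 0 / (1 + z₂ 0) := by simpa [Φ] using congrFun heq 0
    have e1 : z₁ 1 = z₂ 1 := by simpa [Φ] using congrFun heq 1
    rw [div_eq_div_iff (by positivity) (by positivity)] at e0
    have e0' : z₁ 0 = z₂ 0 := by nlinarith
    funext i
    fin_cases i
    · exact e0'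
    · exact e1
  · intro z hz
    have hz0 : (0 : ℝ) ≤ z 0 := (hz 0).1
    rw [hdet, RFun.rep_integrand, RFun.rep_integrand, h z hz, abs_of_nonneg (by positivity)]

/-! ### the halves of `[Gm]`, `[Gp]` -/

/-- Auxiliary definition `GmLDen`: Gm LDen. [bookkeeping] -/
def GmLDen : MvPolynomial (Fin 2) ℚ :=
  (C 2 - X 0) * (C 2 - X 0) - X 1 * X 0 * (C 2 - X 0) + C 2 * X 0 * X 0
/-- Auxiliary definition `GmUDen`: Gm UDen. [bookkeeping] -/
def GmUDen : MvPolynomial (Fin 2) ℚ :=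
  (C 1 - X 0) * (C 1 - X 0) - X 1 * (C 1 + X 0) * (C 1 - X 0) + C 2 * (C 1 + X 0) * (C 1 + X 0)
/-- Auxiliary definition `GmUrDen`: Gm Ur Den. [bookkeeping] -/
def GmUrDen : MvPolynomial (Fin 2) ℚ :=
  X 0 * X 0 - X 1 * (C 2 - X 0) * X 0 + C 2 * (C 2 - X 0) * (C 2 - X 0)
/-- Auxiliary definition `GpLDen`: Gp LDen. [bookkeeping] -/
def GpLDen : MvPolynomial (Fin 2) ℚ :=
  (C 2 - X 0) * (C 2 - X 0) + X 1 * X 0 * (C 2 - X 0) + C 2 * X 0 * X 0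
/-- Auxiliary definition `GpUDen`: Gp UDen. [bookkeeping] -/
def GpUDen : MvPolynomial (Fin 2) ℚ :=
  (C 1 - X 0) * (C 1 - X 0) + X 1 * (C 1 + X 0) * (C 1 - X 0) + C 2 * (C 1 + X 0) * (C 1 + X 0)
/-- Auxiliary definition `GpUrDen`: Gp Ur Den. [bookkeeping] -/
def GpUrDen : MvPolynomial (Fin 2) ℚ :=
  X 0 * X 0 + X 1 * (C 2 - X 0) * X 0 + C 2 * (C 2 - X 0) * (C 2 - X 0)

/-- Auxiliary step `GmLDen_pos`: Gm LDen pos. [bookkeeping] -/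
theorem GmLDen_pos {x : Fin 2 → ℝ} (hx : x ∈ cube 2) : 0 < aeval x GmLDen := by
  have h0 := (hx 0).1; have h0' := (hx 0).2; have h1 := (hx 1).1; have h1' := (hx 1).2
  simp only [GmLDen, map_add, map_sub, map_mul, map_pow, map_neg, aeval_C, aeval_X, map_one, map_ofNat,
      eq_ratCast, Rat.cast_one, Rat.cast_ofNat, Rat.cast_div, Rat.cast_neg, Rat.cast_zero]
  nlinarith [mul_nonneg h0 h1, mul_nonneg (sub_nonneg.2 h0') (sub_nonneg.2 h1'),
    mul_nonneg (mul_nonneg h0 h1) (sub_nonneg.2 h0')]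
/-- Auxiliary step `GmUDen_pos`: Gm UDen pos. [bookkeeping] -/
theorem GmUDen_pos {x : Fin 2 → ℝ} (hx : x ∈ cube 2) : 0 < aeval x GmUDen := by
  have h0 := (hx 0).1; have h0' := (hx 0).2; have h1 := (hx 1).1; have h1' := (hx 1).2
  simp only [GmUDen, map_add, map_sub, map_mul, map_pow, map_neg, aeval_C, aeval_X, map_one, map_ofNat,
      eq_ratCast, Rat.cast_one, Rat.cast_ofNat, Rat.cast_div, Rat.cast_neg, Rat.cast_zero]
  nlinarith [mul_nonneg h0 h1, mul_nonneg (sub_nonneg.2 h0') (sub_nonneg.2 h1'),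
    mul_nonneg (mul_nonneg h0 h1) (sub_nonneg.2 h0'), mul_nonneg h0 h0]
/-- Auxiliary step `GmUrDen_pos`: Gm Ur Den pos. [bookkeeping] -/
theorem GmUrDen_pos {x : Fin 2 → ℝ} (hx : x ∈ cube 2) : 0 < aeval x GmUrDen := by
  have h0 := (hx 0).1; have h0' := (hx 0).2; have h1 := (hx 1).1; have h1' := (hx 1).2
  simp only [GmUrDen, map_add, map_sub, map_mul, map_pow, map_neg, aeval_C, aeval_X, map_one, map_ofNat,
      eq_ratCast, Rat.cast_one, Rat.cast_ofNat, Rat.cast_div, Rat.cast_neg, Rat.cast_zero]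
  nlinarith [mul_nonneg h0 h1, mul_nonneg (sub_nonneg.2 h0') (sub_nonneg.2 h1'),
    mul_nonneg (mul_nonneg h0 h1) (sub_nonneg.2 h0'), mul_nonneg h0 h0]
/-- Auxiliary step `GpLDen_pos`: Gp LDen pos. [bookkeeping] -/
theorem GpLDen_pos {x : Fin 2 → ℝ} (hx : x ∈ cube 2) : 0 < aeval x GpLDen := by
  have h0 := (hx 0).1; have h0' := (hx 0).2; have h1 := (hx 1).1; have h1' := (hx 1).2
  simp only [GpLDen, map_add, map_sub, map_mul, map_pow, map_neg, aeval_C, aeval_X, map_one, map_ofNat,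
      eq_ratCast, Rat.cast_one, Rat.cast_ofNat, Rat.cast_div, Rat.cast_neg, Rat.cast_zero]
  nlinarith [mul_nonneg h0 h1, mul_nonneg (sub_nonneg.2 h0') (sub_nonneg.2 h1'),
    mul_nonneg (mul_nonneg h0 h1) (sub_nonneg.2 h0')]
/-- Auxiliary step `GpUDen_pos`: Gp UDen pos. [bookkeeping] -/
theorem GpUDen_pos {x : Fin 2 → ℝ} (hx : x ∈ cube 2) : 0 < aeval x GpUDen := by
  have h0 := (hx 0).1; have h0' := (hx 0).2; have h1 := (hx 1).1; have h1' := (hx 1).2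
  simp only [GpUDen, map_add, map_sub, map_mul, map_pow, map_neg, aeval_C, aeval_X, map_one, map_ofNat,
      eq_ratCast, Rat.cast_one, Rat.cast_ofNat, Rat.cast_div, Rat.cast_neg, Rat.cast_zero]
  nlinarith [mul_nonneg h0 h1, mul_nonneg (sub_nonneg.2 h0') (sub_nonneg.2 h1'),
    mul_nonneg (mul_nonneg h0 h1) (sub_nonneg.2 h0'), mul_nonneg h0 h0]
/-- Auxiliary step `GpUrDen_pos`: Gp Ur Den pos. [bookkeeping] -/
theorem GpUrDen_pos {x : Fin 2 → ℝ} (hx : x ∈ cube 2) : 0 < aeval x GpUrDen := by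
  have h0 := (hx 0).1; have h0' := (hx 0).2; have h1 := (hx 1).1; have h1' := (hx 1).2
  simp only [GpUrDen, map_add, map_sub, map_mul, map_pow, map_neg, aeval_C, aeval_X, map_one, map_ofNat,
      eq_ratCast, Rat.cast_one, Rat.cast_ofNat, Rat.cast_div, Rat.cast_neg, Rat.cast_zero]
  nlinarith [mul_nonneg h0 h1, mul_nonneg (sub_nonneg.2 h0') (sub_nonneg.2 h1'),
    mul_nonneg (mul_nonneg h0 h1) (sub_nonneg.2 h0'), mul_nonneg h0 h0]

/-- Auxiliary definition `GmL`: Gm L. [bookkeeping] -/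
def GmL : RFun 2 := ⟨C 1, GmLDen, fun _ hx => (GmLDen_pos hx).ne'⟩
/-- Auxiliary definition `GmU`: Gm U. [bookkeeping] -/
def GmU : RFun 2 := ⟨C 1, GmUDen, fun _ hx => (GmUDen_pos hx).ne'⟩
/-- Auxiliary definition `GmUr`: Gm Ur. [bookkeeping] -/
def GmUr : RFun 2 := ⟨C 1, GmUrDen, fun _ hx => (GmUrDen_pos hx).ne'⟩
/-- Auxiliary definition `GpL`: Gp L. [bookkeeping] -/
def GpL : RFun 2 := ⟨C 1, GpLDen, fun _ hx => (GpLDen_pos hx).ne'⟩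
/-- Auxiliary definition `GpU`: Gp U. [bookkeeping] -/
def GpU : RFun 2 := ⟨C 1, GpUDen, fun _ hx => (GpUDen_pos hx).ne'⟩
/-- Auxiliary definition `GpUr`: Gp Ur. [bookkeeping] -/
def GpUr : RFun 2 := ⟨C 1, GpUrDen, fun _ hx => (GpUrDen_pos hx).ne'⟩

/-- Auxiliary step `update_zero_apply_one'`: update zero apply one'. [bookkeeping] -/
@[simp] private theorem update_zero_apply_one' (x : Fin 2 → ℝ) (a : ℝ) : Function.update x 0 a 1 = x 1 := by
  simp
/-- Auxiliary step `update_zero_apply_zero'`: update zero apply zero'. [bookkeeping] -/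
@[simp] private theorem update_zero_apply_zero' (x : Fin 2 → ℝ) (a : ℝ) : Function.update x 0 a 0 = a := by
  simp

/-- `[Gm] ≡ [GmL] + [GmU]` (subdivision at `u = ½`). -/
theorem Gm_subdiv : KZ.of Gm.rep - KZ.of GmL.rep - KZ.of GmU.rep ∈ KZ.relations := by
  refine rel_subdiv 0 Gm GmL GmU (fun x hx => ?_) (fun x hx => ?_)
  · have hA := (GmLDen_pos hx).ne'
    have hB := (GmDen_pos (x := Function.update x 0 (x 0 / 2)) (fun i => by
      fin_cases i
      · exact ⟨by simpa using div_nonneg (hx 0).1 zero_le_two, by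
          simpa using (div_le_iff₀ (zero_lt_two' ℝ)).mpr (by linarith [(hx 0).2])⟩
      · simpa using hx 1)).ne'
    simp only [RFun.fn, map_add, map_sub, map_mul, map_pow, map_neg, aeval_C, aeval_X, map_one, map_ofNat,
      eq_ratCast, Rat.cast_one, Rat.cast_ofNat, Rat.cast_div, Rat.cast_neg, Rat.cast_zero, Gm, GmL, GmDen, GmLDen, update_zero_apply_one',
      update_zero_apply_zero'] at hA hB ⊢
    field_simp
    try ring
  · have hA := (GmUDen_pos hx).ne'
    have hB := (GmDen_pos (x := Function.update x 0 ((1 + x 0) / 2)) (fun i => by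
      fin_cases i
      · exact ⟨by simpa using div_nonneg (by linarith [(hx 0).1]) zero_le_two, by
          simpa using (div_le_iff₀ (zero_lt_two' ℝ)).mpr (by linarith [(hx 0).2])⟩
      · simpa using hx 1)).ne'
    simp only [RFun.fn, map_add, map_sub, map_mul, map_pow, map_neg, aeval_C, aeval_X, map_one, map_ofNat,
      eq_ratCast, Rat.cast_one, Rat.cast_ofNat, Rat.cast_div, Rat.cast_neg, Rat.cast_zero, Gm, GmU, GmDen, GmUDen, update_zero_apply_one',
      update_zero_apply_zero'] at hA hB ⊢
    field_simp
    try ring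

/-- `[Gp] ≡ [GpL] + [GpU]`. -/
theorem Gp_subdiv : KZ.of Gp.rep - KZ.of GpL.rep - KZ.of GpU.rep ∈ KZ.relations := by
  refine rel_subdiv 0 Gp GpL GpU (fun x hx => ?_) (fun x hx => ?_)
  · have hA := (GpLDen_pos hx).ne'
    have hB := (GpDen_pos (x := Function.update x 0 (x 0 / 2)) (fun i => by
      fin_cases i
      · exact ⟨by simpa using div_nonneg (hx 0).1 zero_le_two, by
          simpa using (div_le_iff₀ (zero_lt_two' ℝ)).mpr (by linarith [(hx 0).2])⟩
      · simpa using hx 1)).ne'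
    simp only [RFun.fn, map_add, map_sub, map_mul, map_pow, map_neg, aeval_C, aeval_X, map_one, map_ofNat,
      eq_ratCast, Rat.cast_one, Rat.cast_ofNat, Rat.cast_div, Rat.cast_neg, Rat.cast_zero, Gp, GpL, GpDen, GpLDen, update_zero_apply_one',
      update_zero_apply_zero'] at hA hB ⊢
    field_simp
    try ring
  · have hA := (GpUDen_pos hx).ne'
    have hB := (GpDen_pos (x := Function.update x 0 ((1 + x 0) / 2)) (fun i => by
      fin_cases i
      · exact ⟨by simpa using div_nonneg (by linarith [(hx 0).1]) zero_le_two, by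
          simpa using (div_le_iff₀ (zero_lt_two' ℝ)).mpr (by linarith [(hx 0).2])⟩
      · simpa using hx 1)).ne'
    simp only [RFun.fn, map_add, map_sub, map_mul, map_pow, map_neg, aeval_C, aeval_X, map_one, map_ofNat,
      eq_ratCast, Rat.cast_one, Rat.cast_ofNat, Rat.cast_div, Rat.cast_neg, Rat.cast_zero, Gp, GpU, GpDen, GpUDen, update_zero_apply_one',
      update_zero_apply_zero'] at hA hB ⊢
    field_simp
    try ring

/-- `[GmUr] ≡ [GmU]` (reflection `u ↦ 1 − u`). -/
theorem GmUr_rel : KZ.of GmUr.rep - KZ.of GmU.rep ∈ KZ.relations :=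
  rel_reflect 0 GmU GmUr fun x hx => by
    simp only [RFun.fn, map_add, map_sub, map_mul, map_pow, map_neg, aeval_C, aeval_X, map_one, map_ofNat,
      eq_ratCast, Rat.cast_one, Rat.cast_ofNat, Rat.cast_div, Rat.cast_neg, Rat.cast_zero, GmU, GmUr, GmUDen, GmUrDen, update_zero_apply_one',
      update_zero_apply_zero']
    ring

/-- Auxiliary step `GpUr_rel`: Gp Ur rel. [bookkeeping] -/
theorem GpUr_rel : KZ.of GpUr.rep - KZ.of GpU.rep ∈ KZ.relations :=
  rel_reflect 0 GpU GpUr fun x hx => by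
    simp only [RFun.fn, map_add, map_sub, map_mul, map_pow, map_neg, aeval_C, aeval_X, map_one, map_ofNat,
      eq_ratCast, Rat.cast_one, Rat.cast_ofNat, Rat.cast_div, Rat.cast_neg, Rat.cast_zero, GpU, GpUr, GpUDen, GpUrDen, update_zero_apply_one',
      update_zero_apply_zero']
    ring

/-- `[Sm] ≡ [GmL]` (Möbius `x ↦ 2x/(1+x)`, i.e. `u/2 = x/(1+x)`). -/
theorem Sm_moeb : KZ.of Sm.rep - KZ.of GmL.rep ∈ KZ.relations :=
  rel_moeb Sm GmL fun z hz => by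
    have h0 : (0 : ℝ) ≤ z 0 := (hz 0).1
    have hne : (1 : ℝ) + z 0 ≠ 0 := by positivity
    have hA := (SmDen_pos hz).ne'
    simp only [RFun.fn, map_add, map_sub, map_mul, map_pow, map_neg, aeval_C, aeval_X, map_one, map_ofNat,
      eq_ratCast, Rat.cast_one, Rat.cast_ofNat, Rat.cast_div, Rat.cast_neg, Rat.cast_zero, Sm, GmL, SmDen, GmLDen, vec2_0, vec2_1] at hA ⊢
    have hB : (2 - 2 * z 0 / (1 + z 0)) * (2 - 2 * z 0 / (1 + z 0)) -
        z 1 * (2 * z 0 / (1 + z 0)) * (2 - 2 * z 0 / (1 + z 0)) +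
        2 * (2 * z 0 / (1 + z 0)) * (2 * z 0 / (1 + z 0)) =
        4 * (1 + 2 * z 0 * z 0 - z 1 * z 0) / (1 + z 0) ^ 2 := by
      field_simp
      ring
    rw [hB]
    field_simp
    ring

/-- Auxiliary step `Shm_moeb`: Shm moeb. [bookkeeping] -/
theorem Shm_moeb : KZ.of Shm.rep - KZ.of GmUr.rep ∈ KZ.relations :=
  rel_moeb Shm GmUr fun z hz => by
    have h0 : (0 : ℝ) ≤ z 0 := (hz 0).1
    have hne : (1 : ℝ) + z 0 ≠ 0 := by positivity
    have hA := (ShmDen_pos hz).ne'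
    simp only [RFun.fn, map_add, map_sub, map_mul, map_pow, map_neg, aeval_C, aeval_X, map_one, map_ofNat,
      eq_ratCast, Rat.cast_one, Rat.cast_ofNat, Rat.cast_div, Rat.cast_neg, Rat.cast_zero, Shm, GmUr, ShmDen, GmUrDen, vec2_0, vec2_1] at hA ⊢
    have hB : 2 * z 0 / (1 + z 0) * (2 * z 0 / (1 + z 0)) -
        z 1 * (2 - 2 * z 0 / (1 + z 0)) * (2 * z 0 / (1 + z 0)) +
        2 * (2 - 2 * z 0 / (1 + z 0)) * (2 - 2 * z 0 / (1 + z 0)) =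
        4 * (2 + z 0 * z 0 - z 1 * z 0) / (1 + z 0) ^ 2 := by
      field_simp
      ring
    rw [hB]
    field_simp
    ring

/-- Auxiliary step `Sp_moeb`: Sp moeb. [bookkeeping] -/
theorem Sp_moeb : KZ.of Sp.rep - KZ.of GpL.rep ∈ KZ.relations :=
  rel_moeb Sp GpL fun z hz => by
    have h0 : (0 : ℝ) ≤ z 0 := (hz 0).1
    have hne : (1 : ℝ) + z 0 ≠ 0 := by positivity
    have hA := (SpDen_pos hz).ne'
    simp only [RFun.fn, map_add, map_sub, map_mul, map_pow, map_neg, aeval_C, aeval_X, map_one, map_ofNat,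
      eq_ratCast, Rat.cast_one, Rat.cast_ofNat, Rat.cast_div, Rat.cast_neg, Rat.cast_zero, Sp, GpL, SpDen, GpLDen, vec2_0, vec2_1] at hA ⊢
    have hB : (2 - 2 * z 0 / (1 + z 0)) * (2 - 2 * z 0 / (1 + z 0)) +
        z 1 * (2 * z 0 / (1 + z 0)) * (2 - 2 * z 0 / (1 + z 0)) +
        2 * (2 * z 0 / (1 + z 0)) * (2 * z 0 / (1 + z 0)) =
        4 * (1 + 2 * z 0 * z 0 + z 1 * z 0) / (1 + z 0) ^ 2 := by
      field_simp
      ring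
    rw [hB]
    field_simp
    ring

end Inv
end Summit.KontsevichZagierPeriods.RootDecompQuadraticDescent.Pair18Homotopy
end
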